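import Summits.BirchSwinnertonDyer.Rank1Residual.X11b.LocalTrivialityBridge
import Literature.NumberTheory.EllipticCurves.KummerSelmerStructure
import HarnessLib

/-!
# X11b, route R1 — the finite levels `E[p^k] ↪ E[p^∞]` on `H¹`: kernel (connecting classes of
# invariant points), image (the `p^k`-torsion), injectivity when there are no invariant points

HONEST FRAMING (cell `b2b-bsdres`, run/shared/lean/b2b/bsd-rank1-residual/, verbatim in every
file): the goal of the cell is to DELETE the COMBINATION-SHAPED residual classes of the
Birch–Swinnerton-Dyer formula for ALL analytic-rank `≤ 1` elliptic curves over `ℚ` — "full BSD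
formula for every rank `≤ 1` curve in class `C`" assembled STRICTLY from published theorems — so
that the rank-`≤ 1` remainder becomes exactly the CONSTRUCTION-SHAPED classes, which are TYPED
(missing-input `Prop`s), NOT attempted. This is not "finishing BSD". Sub-cell
`b2b-bsdres-multr1-p1` (X11b, route R1 = Castella 2018 Thm. A re-proved along the author's
erratum); a RESEARCH ROUTE; no claim beyond the stated class; X11b stays CONSTRUCTION-SHAPED;
nothing here changes a label; no named fact is minted (definitions with bodies — coboundary /
lifted / connecting cocycles and classes, and the inclusion `E[p^k] ↪ E[p^∞]` as an intertwining
map — and theorems; no `sorry`).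

## Why (the `W`-side of the limit layer under the Poitou–Tate atoms)

The Poitou–Tate fact of the tree (`poitouTate_selmerStructure_duality`, Howard 2004 Thm. 2.1.11)
is stated for FINITE modules such as `E[p^k]`; route R1's Selmer groups have coefficients
`W = E[p^∞]` (`selmerAcBase`; `LocBridge.primaryGaloisModule`).  The passage is the cohomology of
`0 → E[p^k] → E[p^∞] —p^k→ E[p^∞] → 0` (Greenberg LNM 1716 §2, §5 proof of Prop. 5.8; JSW17 §3.3):
`H¹(F, E[p^k]) → H¹(F, E[p^∞])` has kernel the connecting classes of `E[p^∞]^{Γ_F}`, image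
`H¹(F, E[p^∞])[p^k]`, and is injective when `E[p^∞]^{Γ_F} = 0` (e.g. `E(F)[p] = 0`).  The tree has
the case `k = 1` over `Γ_K` and its subgroups (`exists_torsionToPrimaryH1_eq`,
`exists_torsionToPrimaryH1Sub_eq`) in the `discreteH1` vocabulary.  This file proves the statements
ONCE for an arbitrary injective intertwining map `i : A ↪ B` of discrete Galois modules over an
arbitrary field `F`, with `A` killed by `n` and `range i ⊇ B[n]`, in the `galoisCohomology`
vocabulary where Poitou–Tate lives — so that they apply both over the number field `K` (modules
`W.torsionGaloisModule (p^k)`, `primaryGaloisModule W p`) and over every completion `K_v` (the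
restricted modules `GaloisRep.restrictField K_v _`, discrete Galois modules over the field `K_v`);
the local form defines and computes the PROPAGATED finite-level local conditions of Howard
Def. 2.1.1.

## What is here

* `Levels.cobCocycle ρB b` (`σ ↦ σ b − b`, class `0`), `Levels.liftCocycle` (a cocycle of `B` with
  `n`-torsion values lifts uniquely through `i`; `map_oneCocycleClass_liftCocycle`),
  `Levels.connectingClass … b hb = δ(b)` for `b` with `n • b ∈ B^{Γ_F}` (`= [i⁻¹(σ b − b)]`).
* `Levels.map_connectingClass` (`H¹(i) δ(b) = 0`), **`Levels.map_one_eq_zero_iff_exists`**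
  (`H¹(i) c = 0 ↔ c = δ(b)`), **`Levels.connectingClass_eq_zero_iff`**
  (`δ(b) = 0 ↔ ∃ b₀ ∈ B^{Γ_F}, n • b₀ = n • b`), **`Levels.map_one_injective_of_forall_fixed_eq_zero`**
  (`B^{Γ_F} = 0 ⟹ H¹(i)` injective), `Levels.nsmul_map_one` (`n • H¹(i) c = 0`),
  **`Levels.exists_map_one_eq_of_nsmul_eq_zero`** (`B` `n`-divisible and `n • x = 0 ⟹ x ∈ im H¹(i)`).
* The companion `PrimaryInclusionLevels` specialises everything to
  `primaryInclusion W p k : E[p^k] ↪ E[p^∞]` over `K` and over every `K`-field (completion).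

References: [GreenbergLNM1716] §2 p. 63, §5 proof of Prop. 5.8 (arXiv:math/9809206);
[JetchevSkinnerWan2017] §3.3 (arXiv:1512.06894 pp. 11–13); [Howard2004HeegnerKolyvagin]
Def. 2.1.1 (propagated local conditions); Serre, *Galois Cohomology*, I.§2.2, I.§5.1; Silverman,
*AEC*, VIII.§2 (Kummer sequence).
-/

noncomputable section

open scoped Classical

open CategoryTheory NumberField IsDedekindDomain Field
open Literature.NumberTheory.EllipticCurves
open Literature.NumberTheory.GaloisRepresentations
open scoped ContRepresentation

universe u

namespace Summit.BirchSwinnertonDyer.Rank1Residual.X11b.Levels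

/-! ## §1. Coboundaries and lifts of cocycles through an injective intertwining map -/

section Generic

variable {F : Type u} [Field F] {A B : Type u} [AddCommGroup A] [TopologicalSpace A]
  [DiscreteTopology A] [AddCommGroup B] [TopologicalSpace B] [DiscreteTopology B]
  {ρA : DiscreteGaloisModule F A} (ρB : DiscreteGaloisModule F B)

/-- The coboundary `σ ↦ σ b − b` of `b ∈ B` as a continuous crossed homomorphism of the discrete
Galois module `ρB` (continuity: `ContinuousRep.continuous_apply_left`).
Serre, *Galois Cohomology*, I.§5.1. [folklore] -/
def cobCocycle (b : B) : contOneCocycles ρB.toTopRep :=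
  ⟨⟨fun σ ↦ ρB σ b - b, (ρB.continuous_apply_left b).sub continuous_const⟩, fun g h ↦ by
    change ρB (g * h) b - b = (ρB g b - b) + ρB.toContRepresentation g (ρB h b - b)
    rw [ContinuousRep.toContRepresentation_apply_apply, map_mul, Module.End.mul_apply, map_sub]
    abel⟩

/-- Unfolding `cobCocycle`. [folklore] -/
@[simp]
theorem cobCocycle_apply (b : B) (σ : absoluteGaloisGroup F) :
    (cobCocycle ρB b).1 σ = ρB σ b - b :=
  rfl

/-- A coboundary has class `0` in `H¹(F, B)`. Serre, *Galois Cohomology*, I.§5.1. [folklore] -/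
theorem oneCocycleClass_cobCocycle (b : B) :
    (oneCocycleClass _ (cobCocycle ρB b) : galoisCohomology ρB 1) = 0 :=
  (oneCocycleClass_eq_zero_iff _ _).mpr ⟨b, fun _ ↦ rfl⟩

variable {ρB}

/-- A preimage map `B → A` for `i` on the `n`-torsion: `y ↦ i⁻¹ y` where `hrange` provides a
preimage (unique when `i` is injective), `0` elsewhere. [folklore] -/
def liftTorsion (i : ρA.toContRepresentation →ⁱL ρB.toContRepresentation) (n : ℕ)
    (hrange : ∀ b : B, n • b = 0 → ∃ a : A, i a = b) (y : B) : A :=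
  if h : n • y = 0 then Classical.choose (hrange y h) else 0

/-- `i (i⁻¹ y) = y` for `y ∈ B[n]`. [folklore] -/
theorem apply_liftTorsion {i : ρA.toContRepresentation →ⁱL ρB.toContRepresentation} {n : ℕ}
    {hrange : ∀ b : B, n • b = 0 → ∃ a : A, i a = b} {y : B} (hy : n • y = 0) :
    i (liftTorsion i n hrange y) = y := by
  rw [liftTorsion, dif_pos hy]
  exact Classical.choose_spec (hrange y hy)

/-- **Lifting a cocycle with `n`-torsion values through `i`**: for `i` injective and a continuous
crossed homomorphism `ψ : Γ_F → B` with `n • ψ σ = 0` for all `σ`, `σ ↦ i⁻¹(ψ σ)` is a continuous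
crossed homomorphism of `A` (continuity: `ψ` is continuous into the discrete `B`; the cocycle
identity is checked after applying the injective intertwining map `i`).
Serre, *Galois Cohomology*, I.§2.2. [folklore] -/
def liftCocycle (i : ρA.toContRepresentation →ⁱL ρB.toContRepresentation) (n : ℕ)
    (hrange : ∀ b : B, n • b = 0 → ∃ a : A, i a = b) (hinj : Function.Injective i)
    (ψ : contOneCocycles ρB.toTopRep) (hψ : ∀ σ : absoluteGaloisGroup F, n • ψ.1 σ = 0) :
    contOneCocycles ρA.toTopRep :=
  ⟨⟨fun σ ↦ liftTorsion i n hrange (ψ.1 σ),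
      (continuous_of_discreteTopology (f := liftTorsion i n hrange)).comp ψ.1.continuous⟩,
    fun g h ↦ by
      apply hinj
      change i (liftTorsion i n hrange (ψ.1 (g * h))) =
        i (liftTorsion i n hrange (ψ.1 g) +
          ρA.toContRepresentation g (liftTorsion i n hrange (ψ.1 h)))
      rw [map_add, i.isIntertwining, apply_liftTorsion (hψ _), apply_liftTorsion (hψ _),
        apply_liftTorsion (hψ _)]
      exact ψ.2 g h⟩

/-- Values of the lifted cocycle after `i`: `i (ψ̃ σ) = ψ σ`. [folklore] -/
@[simp]
theorem apply_liftCocycle {i : ρA.toContRepresentation →ⁱL ρB.toContRepresentation} {n : ℕ}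
    {hrange : ∀ b : B, n • b = 0 → ∃ a : A, i a = b} (hinj : Function.Injective i)
    (ψ : contOneCocycles ρB.toTopRep) (hψ : ∀ σ : absoluteGaloisGroup F, n • ψ.1 σ = 0)
    (σ : absoluteGaloisGroup F) :
    i ((liftCocycle i n hrange hinj ψ hψ).1 σ) = ψ.1 σ :=
  apply_liftTorsion (hψ σ)

/-- `H¹(i)` on the class of a cocycle `φ` of `A` vanishes iff `i ∘ φ` is a coboundary in `B`.
[folklore] -/
theorem map_one_oneCocycleClass_eq_zero_iff
    (i : ρA.toContRepresentation →ⁱL ρB.toContRepresentation) (φ : contOneCocycles ρA.toTopRep) :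
    galoisCohomology.map i 1 (oneCocycleClass _ φ) = 0 ↔
      ∃ b : B, ∀ σ : absoluteGaloisGroup F, i (φ.1 σ) = ρB σ b - b := by
  rw [galoisCohomology.map_one_oneCocycleClass]
  exact oneCocycleClass_eq_zero_iff _ _

/-- **`H¹(i) [ψ̃] = [ψ]`**: the lifted cocycle maps back to `ψ`. [folklore] -/
theorem map_oneCocycleClass_liftCocycle
    {i : ρA.toContRepresentation →ⁱL ρB.toContRepresentation} {n : ℕ}
    {hrange : ∀ b : B, n • b = 0 → ∃ a : A, i a = b} (hinj : Function.Injective i)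
    (ψ : contOneCocycles ρB.toTopRep) (hψ : ∀ σ : absoluteGaloisGroup F, n • ψ.1 σ = 0) :
    galoisCohomology.map i 1 (oneCocycleClass _ (liftCocycle i n hrange hinj ψ hψ)) =
      oneCocycleClass _ ψ := by
  rw [galoisCohomology.map_one_oneCocycleClass]
  exact congrArg (oneCocycleClass _) (Subtype.ext (ContinuousMap.ext fun σ ↦
    apply_liftCocycle hinj ψ hψ σ))

/-! ## §2. The connecting classes `δ(b)`, `n • b ∈ B^{Γ_F}`, and the kernel of `H¹(i)` -/

/-- For `b ∈ B` with `n • b` fixed by `Γ_F`, the coboundary `σ ↦ σ b − b` takes `n`-torsion values.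
[folklore] -/
theorem nsmul_cobCocycle_apply_eq_zero (n : ℕ) {b : B}
    (hb : ∀ σ : absoluteGaloisGroup F, ρB σ (n • b) = n • b) (σ : absoluteGaloisGroup F) :
    n • (cobCocycle ρB b).1 σ = 0 := by
  rw [cobCocycle_apply, smul_sub, ← map_nsmul, hb σ, sub_self]

/-- **The connecting class `δ(b) = [σ ↦ i⁻¹(σ b − b)] ∈ H¹(F, A)`** of `b ∈ B` with
`n • b ∈ B^{Γ_F}` — the image of `n • b` under the connecting homomorphism
`B^{Γ_F} → H¹(F, A)` of `0 → A —i→ B —n→ B` (Kummer sequence).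
Silverman, *AEC*, VIII.§2; Greenberg LNM 1716, §5 proof of Prop. 5.8. [folklore] -/
def connectingClass (i : ρA.toContRepresentation →ⁱL ρB.toContRepresentation) (n : ℕ)
    (hrange : ∀ b : B, n • b = 0 → ∃ a : A, i a = b) (hinj : Function.Injective i) (b : B)
    (hb : ∀ σ : absoluteGaloisGroup F, ρB σ (n • b) = n • b) : galoisCohomology ρA 1 :=
  oneCocycleClass _ (liftCocycle i n hrange hinj (cobCocycle ρB b)
    (nsmul_cobCocycle_apply_eq_zero n hb))

variable {i : ρA.toContRepresentation →ⁱL ρB.toContRepresentation} {n : ℕ}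
  {hrange : ∀ b : B, n • b = 0 → ∃ a : A, i a = b}

/-- **`H¹(i) δ(b) = 0`** (exactness of the Kummer sequence at `H¹(F, A)`, easy half: `δ(b)` pushes
forward to the coboundary of `b`). [folklore] -/
theorem map_connectingClass (hinj : Function.Injective i) (b : B)
    (hb : ∀ σ : absoluteGaloisGroup F, ρB σ (n • b) = n • b) :
    galoisCohomology.map i 1 (connectingClass i n hrange hinj b hb) = 0 := by
  rw [connectingClass, map_oneCocycleClass_liftCocycle]
  exact oneCocycleClass_cobCocycle ρB b

/-- **Exactness of `B^{Γ_F} —δ→ H¹(F, A) —H¹(i)→ H¹(F, B)` at `H¹(F, A)`** (for `A` killed by `n`):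
a class dies under `H¹(i)` iff it is a connecting class `δ(b)` with `n • b ∈ B^{Γ_F}`.  (If
`[i ∘ φ] = 0` then `i(φ σ) = σ b − b` for some `b ∈ B`; `n` kills the left side, so `n • b` is
invariant, and `φ` IS the lift of the coboundary of `b` by injectivity of `i`.)
[cite: GreenbergLNM1716, §5 proof of Prop. 5.8] -/
theorem map_one_eq_zero_iff_exists (hinj : Function.Injective i) (hA : ∀ a : A, n • a = 0)
    (c : galoisCohomology ρA 1) :
    galoisCohomology.map i 1 c = 0 ↔
      ∃ (b : B) (hb : ∀ σ : absoluteGaloisGroup F, ρB σ (n • b) = n • b),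
        c = connectingClass i n hrange hinj b hb := by
  constructor
  · intro hc
    obtain ⟨φ, rfl⟩ := oneCocycleClass_surjective _ c
    obtain ⟨b, hb⟩ := (map_one_oneCocycleClass_eq_zero_iff i φ).mp hc
    have hfix : ∀ σ : absoluteGaloisGroup F, ρB σ (n • b) = n • b := fun σ ↦ by
      have h0 : n • (ρB σ b - b) = 0 := by rw [← hb σ, ← map_nsmul, hA, map_zero]
      rwa [smul_sub, ← map_nsmul, sub_eq_zero] at h0
    refine ⟨b, hfix, congrArg (oneCocycleClass _) (Subtype.ext (ContinuousMap.ext fun σ ↦ ?_))⟩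
    apply hinj
    rw [hb σ]
    exact (apply_liftCocycle hinj (cobCocycle ρB b) (nsmul_cobCocycle_apply_eq_zero n hfix) σ).symm
  · rintro ⟨b, hb, rfl⟩
    exact map_connectingClass hinj b hb

/-- **`δ(b) = 0 ↔ ∃ b₀ ∈ B^{Γ_F}, n • b₀ = n • b`** (exactness at `B^{Γ_F}`: the kernel of the
connecting homomorphism on `B^{Γ_F}` is `n • B^{Γ_F}`).  (`⟹`: `i⁻¹(σ b − b) = σ a − a` gives
`b₀ = b − i a` invariant; `⟸`: `b − b₀ ∈ B[n] = range i`, so the cocycle is the coboundary of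
`i⁻¹(b − b₀)`.) Silverman, *AEC*, VIII.§2. [folklore] -/
theorem connectingClass_eq_zero_iff (hinj : Function.Injective i) (hA : ∀ a : A, n • a = 0)
    (b : B) (hb : ∀ σ : absoluteGaloisGroup F, ρB σ (n • b) = n • b) :
    connectingClass i n hrange hinj b hb = 0 ↔
      ∃ b₀ : B, (∀ σ : absoluteGaloisGroup F, ρB σ b₀ = b₀) ∧ n • b₀ = n • b := by
  refine (oneCocycleClass_eq_zero_iff _ _).trans ?_
  constructor
  · rintro ⟨a, ha⟩
    refine ⟨b - i a, fun σ ↦ ?_, by rw [smul_sub, ← map_nsmul, hA, map_zero, sub_zero]⟩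
    have h := congrArg i (ha σ)
    rw [apply_liftCocycle, cobCocycle_apply, map_sub] at h
    have h' : i (ρA.toTopRep.ρ σ a) = ρB σ (i a) := i.isIntertwining σ a
    rw [h'] at h
    rw [map_sub]
    calc ρB σ b - ρB σ (i a) = (ρB σ b - b) - (ρB σ (i a) - i a) + (b - i a) := by abel
      _ = b - i a := by rw [h, sub_self, zero_add]
  · rintro ⟨b₀, hb₀, hn⟩
    obtain ⟨a, ha⟩ := hrange (b - b₀) (by rw [smul_sub, hn, sub_self])
    refine ⟨a, fun σ ↦ hinj ?_⟩
    rw [apply_liftCocycle, cobCocycle_apply, map_sub]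
    have h' : i (ρA.toTopRep.ρ σ a) = ρB σ (i a) := i.isIntertwining σ a
    rw [h', ha, map_sub, hb₀]
    abel

/-- **`B^{Γ_F} = 0 ⟹ H¹(i) : H¹(F, A) → H¹(F, B)` is injective** (no invariant points: every
connecting class is `δ(b)` with `n • b ∈ B^{Γ_F} = 0 = n • 0`).  For `B = E[p^∞]` the hypothesis
is `E(F)[p] = 0`. Greenberg LNM 1716 §2 p. 63; JSW17 §3.1 (irr_K). [cite: GreenbergLNM1716, §2 p. 63] -/
theorem map_one_injective_of_forall_fixed_eq_zero
    (hrange : ∀ b : B, n • b = 0 → ∃ a : A, i a = b) (hinj : Function.Injective i)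
    (hA : ∀ a : A, n • a = 0)
    (hΓ : ∀ b : B, (∀ σ : absoluteGaloisGroup F, ρB σ b = b) → b = 0) :
    Function.Injective (galoisCohomology.map i 1) := by
  rw [injective_iff_map_eq_zero]
  intro c hc
  obtain ⟨b, hb, rfl⟩ := (map_one_eq_zero_iff_exists (hrange := hrange) hinj hA c).mp hc
  rw [connectingClass_eq_zero_iff hinj hA]
  exact ⟨0, fun σ ↦ map_zero _, by rw [smul_zero, hΓ _ hb]⟩

/-! ## §3. The image of `H¹(i)` is the `n`-torsion (`B` `n`-divisible) -/

/-- `n • H¹(i) c = 0`: the image of `H¹(i)` is `n`-torsion (`A` is killed by `n`). [folklore] -/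
theorem nsmul_map_one (i : ρA.toContRepresentation →ⁱL ρB.toContRepresentation)
    (hA : ∀ a : A, n • a = 0) (c : galoisCohomology ρA 1) :
    n • galoisCohomology.map i 1 c = 0 := by
  obtain ⟨φ, rfl⟩ := oneCocycleClass_surjective _ c
  have hφ : (n : ℤ) • φ = 0 := Subtype.ext (ContinuousMap.ext fun σ ↦ by
    change (n : ℤ) • φ.1 σ = 0
    rw [natCast_zsmul, hA])
  have h := oneCocycleClass_smul ρA.toTopRep (n : ℤ) φ
  rw [hφ, oneCocycleClass_zero] at h
  conv at h => rhs; rw [Nat.cast_smul_eq_nsmul]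
  have h' : (n • oneCocycleClass ρA.toTopRep φ : galoisCohomology ρA 1) = 0 := h.symm
  rw [← map_nsmul]
  exact (congrArg (galoisCohomology.map i 1) h').trans (map_zero _)

/-- **`H¹(F, A) ↠ H¹(F, B)[n]`** for `B` `n`-divisible: an `n`-torsion class `[ψ]` of `H¹(F, B)`
satisfies `n ψ = ∂a`, `a = n a'`, and `ψ − ∂a'` has `n`-torsion values, hence lifts through `i`.
(Exactness of `H¹(F, A) → H¹(F, B) —n→ H¹(F, B)`; the tree's `exists_torsionToPrimaryH1_eq` is the
case `A = E[p]`, `B = E[p^∞]` over `Γ_K` in the `discreteH1` vocabulary.)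
[cite: GreenbergLNM1716, §5 proof of Prop. 5.8] -/
theorem exists_map_one_eq_of_nsmul_eq_zero
    (hrange : ∀ b : B, n • b = 0 → ∃ a : A, i a = b) (hinj : Function.Injective i)
    (hdiv : ∀ b : B, ∃ b' : B, n • b' = b) {x : galoisCohomology ρB 1} (hx : n • x = 0) :
    ∃ c : galoisCohomology ρA 1, galoisCohomology.map i 1 c = x := by
  obtain ⟨ψ, rfl⟩ := oneCocycleClass_surjective _ x
  have h := oneCocycleClass_smul ρB.toTopRep (n : ℤ) ψ
  conv at h => rhs; rw [Nat.cast_smul_eq_nsmul]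
  have h0 : oneCocycleClass ρB.toTopRep ((n : ℤ) • ψ) = 0 := h.trans hx
  obtain ⟨a, ha⟩ := (oneCocycleClass_eq_zero_iff _ _).mp h0
  obtain ⟨a', rfl⟩ := hdiv a
  -- `ψ' = ψ − ∂a'` has `n`-torsion values
  have hψ' : ∀ σ : absoluteGaloisGroup F, n • (ψ - cobCocycle ρB a').1 σ = 0 := fun σ ↦ by
    change n • (ψ.1 σ - (ρB σ a' - a')) = 0
    have h1 : (n : ℤ) • ψ.1 σ = ρB σ (n • a') - n • a' := ha σ
    rw [natCast_zsmul, map_nsmul] at h1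
    rw [smul_sub, h1, smul_sub, sub_self]
  refine ⟨oneCocycleClass _ (liftCocycle i n hrange hinj _ hψ'), ?_⟩
  rw [map_oneCocycleClass_liftCocycle, oneCocycleClass_sub]
  have hc : (oneCocycleClass _ (cobCocycle ρB a') : galoisCohomology ρB 1) = 0 :=
    oneCocycleClass_cobCocycle ρB a'
  rw [hc, sub_zero]

/-- **`im H¹(i) = H¹(F, B)[n]`** for `A` killed by `n` and `B` `n`-divisible. [folklore] -/
theorem mem_range_map_one_iff
    (hrange : ∀ b : B, n • b = 0 → ∃ a : A, i a = b) (hinj : Function.Injective i)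
    (hA : ∀ a : A, n • a = 0) (hdiv : ∀ b : B, ∃ b' : B, n • b' = b)
    (x : galoisCohomology ρB 1) :
    x ∈ (galoisCohomology.map i 1).range ↔ n • x = 0 := by
  constructor
  · rintro ⟨c, rfl⟩
    exact nsmul_map_one i hA c
  · intro hx
    exact exists_map_one_eq_of_nsmul_eq_zero hrange hinj hdiv hx

end Generic

end Summit.BirchSwinnertonDyer.Rank1Residual.X11b.Levels

end
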